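import Literature.Barriers.QuantumAdvantage.FFKLBrain
import Literature.Computability.Complexity.AdaptiveQueries
import Literature.Computability.Complexity.BrainProtocol
import HarnessLib

/-!
# The Standard Algorithm as a `P^{B ⊕ G}` machine (Fenner–Fortnow–Kurtz–Li, Lemma 6.16 and Thm. 6.18 (2)): `fennerFortnowKurtzLi2003_thm618_awpp` discharged

Support file closing the named fact
`Literature.Barriers.QuantumAdvantage.fennerFortnowKurtzLi2003_thm618_awpp` (Fenner–Fortnow–
Kurtz–Li, *An oracle builder's toolkit*, Inform. and Comput. 182 (2003), Thm. 6.18 (2)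
rerelativized: for every Karp-`PSPACE`-complete `B` there is a countable family of sets of Cohen
conditions with `P^{B ⊕ G} = AWPP^{B ⊕ G}` for every generic `G`).

`FFKLGenericCollapse.lean` reduced the fact, by proof, to the Standard Algorithm statement for
categorical descriptions (`fennerFortnowKurtzLi2003_thm618_awpp_of_stdAlg`); the layers
`FFKLWindow.lean` (Thm. 6.13), `FFKLSegments.lean`/`FFKLTablePredicate.lean` (the `PSPACE`
table test), `FFKLCertificates.lean` (Lemma 6.17: the supplier `pick` of least good codes meets
`StdAlg.PickSpec`), `StandardAlgorithm.lean` (Lemma 6.9: `StdAlg.decide_eq`) and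
`FFKLBrain.lean` (the `PSPACE` language `K` spelling the codes bitwise, `KLang_mem_PSPACE`,
`mem_KLang_iff_kbit`) are assembled here into the polynomial-time oracle machine of
**Lemma 6.16** (p. 33: "for any categorical `M_j`, `L(M_j^G) ∈ P^{G ⊕ F_j}`") relative to
`B ⊕ G`, `K` being Karp-reduced to the complete `B` (Thm. 6.18 (2) with pp. 33–34):

* the machine is the bounded adaptive reduction `AdQuery.adLang Q (histLen + 1) Verdict` of
  `AdaptiveQueries.lean` with the query map `AWPPDescr.qryFn`: at history `h` of length
  `≡ T (mod W)` it PROBES `G` on the string spelled backwards by the last `T` answer bits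
  (`probeFn`: `1 · fstP ((h ⇂ S·W)ʳ)`, `fstP_reverse_append_mkCode`), otherwise it ASKS `B` the
  Karp image of `0 · ⟨x, h⟩ ∈ K` (`0 · f ⟨x, h⟩`); it accepts iff the last answer (the verdict query) is
  `1` (`BrainProtocol.Verdict`); `machineLang_mem_PRel`;
* the canonical run (`AWPPDescr.Run.*`): the knowledge `ρ_r = StdAlg.know pick x_G r`, the round
  codes `roundCode ρ_r`, the probed strings, their answers, the segments and the full history
  `fullHist`; PROVED: the knowledge read off the history of `r` rounds is `ρ_r`
  (`knowOf_histR`), the machine's answer bits are the canonical history (`adBits_eq_take`), and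
  the verdict is `StdAlg.decide = f(x_G) = [x ∈ L(Δ^{B ⊕ G})]` (`mem_machineLang_iff`);
* **`stdAlg_collapse`** — the hypothesis `hstd` of `fennerFortnowKurtzLi2003_thm618_awpp_of_stdAlg`,
  and **`fennerFortnowKurtzLi2003_thm618_awpp_holds`**.

## References

* [FennerFortnowKurtzLi2003IC] Fig. 1 and Lemma 6.9 (p. 29), Lemma 6.16, Lemma 6.17,
  Thm. 6.18 (2) (p. 33), pp. 33–34, read via `lit read doi:10.1016/s0890-5401(03)00018-x --pages 25-34`.
* [FortnowRogers1999JCSS] Thm. 3.6 and proof of Thm. 4.2 (p. 7: the machine "can use its access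
  to `H` to figure out what `M` would do").
* [LadnerLynchSelman1975] §2 (`≤ᵖ_T`: adaptive queries).
-/

noncomputable section

namespace Literature.Barriers.QuantumAdvantage

open _root_.Computability Literature.Computability.Complexity Literature.Computability.Complexity.Classes
  Literature.Computability.Complexity.CohenCondition Literature.Computability.QuantumComplexity
  Polynomial OracleCompose UnaryOffsets CertificateAlgorithm FFKL

/-! ### List slicing by blocks -/

namespace FFKL

/-- Taking a whole number of width-`W` blocks. [folklore] -/
theorem take_flatten_blocks {W : ℕ} {bs : List (List Bool)} (hlen : ∀ b ∈ bs, b.length = W) (m : ℕ) :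
    bs.flatten.take (m * W) = (bs.take m).flatten := by
  induction bs generalizing m with
  | nil => simp
  | cons b bs ih =>
    cases m with
    | zero => simp
    | succ m =>
      have hb : b.length = W := hlen b (by simp)
      rw [List.flatten_cons, show (m + 1) * W = b.length + m * W by rw [hb]; ring, List.take_length_add_append,
        ih (fun b' hb' => hlen b' (by simp [hb'])) m, List.take_succ_cons, List.flatten_cons]

/-- Reading a bit of a concatenation of width-`W` blocks. [folklore] -/
theorem getD_flatten_blocks {W : ℕ} {bs : List (List Bool)} (hlen : ∀ b ∈ bs, b.length = W) {j o : ℕ}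
    (hj : j < bs.length) (ho : o < W) : bs.flatten.getD (j * W + o) false = (bs[j]).getD o false := by
  rw [← UnaryOffsets.getD_window bs.flatten (j * W) W ho, ← segOf, segOf_flatten_of_lt hlen hj]

/-- The block starting at a block boundary. [folklore] -/
theorem take_drop_flatten_blocks {W : ℕ} {bs : List (List Bool)} (hlen : ∀ b ∈ bs, b.length = W) {j : ℕ}
    (hj : j < bs.length) {m : ℕ} (hm : m ≤ W) : (bs.flatten.drop (j * W)).take m = (bs[j]).take m := by
  have h := segOf_flatten_of_lt hlen hj
  unfold segOf UnaryOffsets.window at h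
  have hlenj : W ≤ (bs.flatten.drop (j * W)).length := by
    rw [List.length_drop, length_flatten_of_blocks hlen]
    have : (j + 1) * W ≤ bs.length * W := Nat.mul_le_mul_right _ hj
    rw [Nat.succ_mul] at this
    omega
  rw [List.take_append_of_le_length hlenj] at h
  rw [← h, List.take_take, min_eq_left hm]

/-- For a list of length `T + 1`, the tail of its reversal is the reversal of its first `T` entries. [folklore] -/
theorem reverse_tail_of_length {T : ℕ} {l : List Bool} (h : l.length = T + 1) : l.reverse.tail = (l.take T).reverse := by
  have hT : T < l.length := by omega
  have hl : l.take T ++ [l[T]] = l := by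
    rw [List.take_append_getElem hT, List.take_of_length_le (le_of_eq h)]
  conv_lhs => rw [← hl]
  rw [List.reverse_append, List.reverse_singleton, List.singleton_append, List.tail_cons]

end FFKL

/-! ### Time decomposition -/

/-- Every time `t < Rr·Cs·W` is `r·(Cs·W) + k·W + o` with `r < Rr`, `k < Cs`, `o < W`, and the
quotients the two sides compute. [folklore] -/
theorem exists_time_decomp {Rr Cs W t : ℕ} (ht : t < Rr * (Cs * W)) :
    ∃ r k o, r < Rr ∧ k < Cs ∧ o < W ∧ t = r * (Cs * W) + k * W + o ∧
      t / W = r * Cs + k ∧ t % W = o ∧ t / W / Cs = r ∧ t / W % Cs = k := by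
  have hW : 0 < W := Nat.pos_of_ne_zero fun h => by simp [h] at ht
  have hCs : 0 < Cs := Nat.pos_of_ne_zero fun h => by simp [h] at ht
  refine ⟨t / W / Cs, t / W % Cs, t % W, ?_, Nat.mod_lt _ hCs, Nat.mod_lt _ hW, ?_, ?_, rfl, rfl, rfl⟩
  · rw [Nat.div_div_eq_div_mul, Nat.div_lt_iff_lt_mul (Nat.mul_pos hW hCs)]
    rwa [Nat.mul_comm W Cs]
  · have h1 := Nat.div_add_mod t W
    have h2 := Nat.div_add_mod (t / W) Cs
    calc t = W * (t / W) + t % W := h1.symm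
      _ = W * (Cs * (t / W / Cs) + t / W % Cs) + t % W := by rw [h2]
      _ = t / W / Cs * (Cs * W) + t / W % Cs * W + t % W := by ring
  · have h2 := Nat.div_add_mod (t / W) Cs
    linarith [Nat.mul_comm Cs (t / W / Cs)]

namespace AWPPDescr

/-! ### The machine -/

section Machine

variable (Δ : AWPPDescr)

/-- **"A probe is due"**: the history has length `≡ T (mod W)` (all code bits of the current
segment received). [cite: FennerFortnowKurtzLi2003IC, Lemma 6.16 (p. 33)] -/
def PendPos : Language Bool :=
  {u | (Plumb.modLenFn ∘ pairFn (Plumb.polyFn Δ.segW ∘ fstP) sndP) u = (Plumb.polyFn Δ.codeW ∘ fstP) u}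

/-- **The probe**: `1 · fstP ((h ⇂ S·W)ʳ)` — the string spelled backwards by the code bits of the
current segment. [cite: FennerFortnowKurtzLi2003IC, Fig. 1 (p. 29, "α := α ∪ (G restricted to dom β)")] -/
def probeFn : List Bool → List Bool := List.cons true ∘ fstP ∘ List.reverse ∘ KSide.cpFn Δ.segW

/-- **The query map of the machine**: the probe at segment ends, else the question to `B`,
`0 · f(⟨x, h⟩)` with `f` the Karp reduction of `K` to `B`. [cite: FennerFortnowKurtzLi2003IC, Lemma 6.16 and Thm. 6.18 (2) (p. 33, `P = PSPACE` relative to `B`)] -/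
def qryFn (f : List Bool → List Bool) : List Bool → List Bool :=
  condFn Δ.PendPos Δ.probeFn (List.cons false ∘ f)

/-- The round budget: the full history and the verdict query. [cite: FennerFortnowKurtzLi2003IC, Lemma 6.9 (p. 29) and Lemma 6.16] -/
def budget : Polynomial ℕ := Δ.histLen + 1

/-- **The language of the machine** relative to `B ⊕ G`. [cite: FennerFortnowKurtzLi2003IC, Lemma 6.16 (p. 33)] -/
def machineLang (B : Language Bool) (f : List Bool → List Bool) (G : Language Bool) : Language Bool :=
  AdQuery.adLang (Δ.qryFn f) Δ.budget BrainProtocol.Verdict (oracleJoin B G)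

/-- `PendPos ∈ P`. [cite: AroraBarakCC2009, §1.3] -/
theorem PendPos_mem_P : Δ.PendPos ∈ Classes.P :=
  setOf_apply_eq_apply_mem_P
    (comp_mem_FP Plumb.modLenFn_mem_FP (pairFn_mem_FP (comp_mem_FP (Plumb.polyFn_mem_FP _) fstP_mem_FP) sndP_mem_FP))
    (comp_mem_FP (Plumb.polyFn_mem_FP _) fstP_mem_FP)

/-- `probeFn ∈ FP`. [cite: AroraBarakCC2009, §1.3] -/
theorem probeFn_mem_FP : Δ.probeFn ∈ FP :=
  comp_mem_FP (cons_mem_FP true) (comp_mem_FP fstP_mem_FP (comp_mem_FP BinSearchPP.reverse_mem_FP (KSide.cpFn_mem_FP _)))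

/-- `qryFn f ∈ FP` for `f ∈ FP`. [cite: AroraBarakCC2009, §1.3] -/
theorem qryFn_mem_FP {f : List Bool → List Bool} (hf : f ∈ FP) : Δ.qryFn f ∈ FP :=
  condFn_mem_FP Δ.PendPos_mem_P Δ.probeFn_mem_FP (comp_mem_FP (cons_mem_FP false) hf)

/-- **The machine is a `P^{B ⊕ G}` machine.** [cite: FennerFortnowKurtzLi2003IC, Lemma 6.16 (p. 33)] [cite: LadnerLynchSelman1975, §2] -/
theorem machineLang_mem_PRel (B : Language Bool) {f : List Bool → List Bool} (hf : f ∈ FP) (G : Language Bool) :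
    Δ.machineLang B f G ∈ PRel (Oracle.ofLanguage (oracleJoin B G)) :=
  AdQuery.adLang_mem_PRel (Δ.qryFn_mem_FP hf) BrainProtocol.Verdict_mem_P _

/-- Semantics of `PendPos`. [folklore] -/
theorem mem_PendPos_iff (x h : List Bool) :
    boolPair x h ∈ Δ.PendPos ↔ h.length % Δ.segW.eval x.length = Δ.codeW.eval x.length := by
  show (Plumb.modLenFn ∘ pairFn (Plumb.polyFn Δ.segW ∘ fstP) sndP) (boolPair x h) = (Plumb.polyFn Δ.codeW ∘ fstP) (boolPair x h) ↔ _
  simp only [Function.comp_apply, pairFn_apply, fstP_boolPair, sndP_boolPair, Plumb.polyFn_apply, Plumb.modLenFn_boolPair,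
    ADH.ones_inj]

/-- Semantics of `probeFn`. [folklore] -/
theorem probeFn_apply (x h : List Bool) :
    Δ.probeFn (boolPair x h) = true :: fstP (h.drop (h.length / Δ.segW.eval x.length * Δ.segW.eval x.length)).reverse := by
  simp only [probeFn, Function.comp_apply, KSide.cpFn_apply]

/-- The query when a probe is due. [folklore] -/
theorem qryFn_of_pend (f : List Bool → List Bool) {x h : List Bool}
    (hp : h.length % Δ.segW.eval x.length = Δ.codeW.eval x.length) :
    Δ.qryFn f (boolPair x h) = true :: fstP (h.drop (h.length / Δ.segW.eval x.length * Δ.segW.eval x.length)).reverse := by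
  rw [qryFn, condFn_of_mem _ _ ((Δ.mem_PendPos_iff x h).2 hp), probeFn_apply]

/-- The query when no probe is due. [folklore] -/
theorem qryFn_of_not_pend (f : List Bool → List Bool) {x h : List Bool}
    (hp : h.length % Δ.segW.eval x.length ≠ Δ.codeW.eval x.length) :
    Δ.qryFn f (boolPair x h) = false :: f (boolPair x h) := by
  rw [qryFn, condFn_of_not_mem _ _ (fun hm => hp ((Δ.mem_PendPos_iff x h).1 hm))]
  rfl

end Machine

/-! ### The canonical run -/

section Run

variable (Δ : AWPPDescr) (B : Language Bool) (σ : CohenCondition) (x : List Bool) (G : Language Bool)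

/-- The window assignment of `G` (the hidden input of the Standard Algorithm). [cite: FennerFortnowKurtzLi2003IC, Thm. 6.13 (proof, p. 32, "y induced by the oracle A")] -/
def xG : Fin (Δ.winCard σ x.length) → Bool := Δ.windowOf σ x.length G

/-- The supplier at the sizes of `x`. [cite: FennerFortnowKurtzLi2003IC, §6.3 eq. (6) (p. 29)] -/
def pickX : (Fin (Δ.winCard σ x.length) → Option Bool) → Option (Fin (Δ.winCard σ x.length) → Option Bool) :=
  Δ.pick B σ x (Δ.segW.eval x.length) (Δ.codeLen.eval x.length)

/-- **The knowledge after `r` rounds** (`StdAlg.know`). [cite: FennerFortnowKurtzLi2003IC, Fig. 1 (p. 29, α)] -/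
def knowR (r : ℕ) : Fin (Δ.winCard σ x.length) → Option Bool := StdAlg.know (Δ.pickX B σ x) (Δ.xG σ x G) r

/-- **The code of round `r`.** [cite: FennerFortnowKurtzLi2003IC, Fig. 1 (p. 29, "⟨β₀, β₁⟩ := f^σ(x, α)")] -/
def code (r : ℕ) : List Bool := Δ.roundCode B σ x (Δ.knowR B σ x G r)

/-- The string named by slot `j` of a code `c`: the first component of the reversal of the first
`T` bits of its `j`-th segment (what the machine probes and what the table reads, `segStr`). [cite: FennerFortnowKurtzLi2003IC, Lemma 6.16 (p. 33)] -/
def zOf (c : List Bool) (j : ℕ) : List Bool :=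
  fstP ((segOf (Δ.segW.eval x.length) c j).take (Δ.codeW.eval x.length)).reverse

/-- **The probe of round `r`, slot `k`.** [cite: FennerFortnowKurtzLi2003IC, Fig. 1 (p. 29)] -/
def probe (r k : ℕ) : List Bool := Δ.zOf x (Δ.code B σ x G r) k

/-- **The segment of round `r`, slot `k`**: the code bits received from `B`, then `G`'s answer. [cite: FennerFortnowKurtzLi2003IC, Lemma 6.16 (p. 33)] -/
def seg (r k : ℕ) : List Bool :=
  (segOf (Δ.segW.eval x.length) (Δ.code B σ x G r) k).take (Δ.codeW.eval x.length) ++ [G.boolIndicator (Δ.probe B σ x G r k)]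

/-- All segments of the run, in order. [cite: FennerFortnowKurtzLi2003IC, Lemma 6.16 (p. 33)] -/
def allSegs : List (List Bool) :=
  (List.range (Δ.rounds.eval x.length * Δ.slots.eval x.length)).map fun j =>
    Δ.seg B σ x G (j / Δ.slots.eval x.length) (j % Δ.slots.eval x.length)

/-- **The full history** of answer bits of the probing rounds. [cite: FennerFortnowKurtzLi2003IC, Lemma 6.16 (p. 33)] -/
def fullHist : List Bool := (Δ.allSegs B σ x G).flatten

/-- The history after `r` complete rounds. [cite: FennerFortnowKurtzLi2003IC, Fig. 1 (p. 29)] -/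
def histR (r : ℕ) : List Bool := (Δ.fullHist B σ x G).take (r * Δ.codeLen.eval x.length)

variable {Δ B σ x G}

/-- `W = T + 1`. [folklore] -/
theorem segW_eq : Δ.segW.eval x.length = Δ.codeW.eval x.length + 1 := Δ.segW_eval x.length

/-- A segment of the run has width `W`. [folklore] -/
theorem length_seg (r k : ℕ) : (Δ.seg B σ x G r k).length = Δ.segW.eval x.length := by
  rw [seg, List.length_append, List.length_take, segOf, UnaryOffsets.length_window, List.length_singleton, segW_eq,
    min_eq_left (Nat.le_succ _)]

/-- All segments of the run have width `W`. [folklore] -/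
theorem length_of_mem_allSegs : ∀ b ∈ Δ.allSegs B σ x G, b.length = Δ.segW.eval x.length := by
  intro b hb
  obtain ⟨j, -, rfl⟩ := List.mem_map.1 hb
  exact length_seg _ _

/-- The number of segments. [folklore] -/
theorem length_allSegs : (Δ.allSegs B σ x G).length = Δ.rounds.eval x.length * Δ.slots.eval x.length := by
  rw [allSegs, List.length_map, List.length_range]

/-- `Lc = Cs · W`. [folklore] -/
theorem codeLen_eq : Δ.codeLen.eval x.length = Δ.slots.eval x.length * Δ.segW.eval x.length := Δ.codeLen_eval x.length

/-- The full history has length `histLen = rounds · Lc`. [folklore] -/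
theorem length_fullHist : (Δ.fullHist B σ x G).length = Δ.rounds.eval x.length * Δ.codeLen.eval x.length := by
  rw [fullHist, length_flatten_of_blocks length_of_mem_allSegs, length_allSegs, codeLen_eq, Nat.mul_assoc]

/-- The string named by a segment of a code is `zOf`. [folklore] -/
theorem segStr_segOf (c : List Bool) (j : ℕ) : segStr (segOf (Δ.segW.eval x.length) c j) = Δ.zOf x c j := by
  unfold segStr zOf
  rw [reverse_tail_of_length]
  rw [segOf, UnaryOffsets.length_window, segW_eq]

/-- A segment of the run names its probe. [folklore] -/
theorem segStr_seg (r k : ℕ) : segStr (Δ.seg B σ x G r k) = Δ.probe B σ x G r k := by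
  unfold segStr seg probe zOf
  rw [List.reverse_append, List.reverse_singleton, List.singleton_append, List.tail_cons]

/-- A segment of the run carries `G`'s answer on its probe. [folklore] -/
theorem segVal_seg (r k : ℕ) : segVal (Δ.seg B σ x G r k) ↔ G.boolIndicator (Δ.probe B σ x G r k) = true := by
  unfold segVal seg
  rw [List.reverse_append, List.reverse_singleton, List.singleton_append, List.head?_cons, Option.some.injEq]

/-- Strings named by zero segments are not window strings (they are too long). [folklore] -/
theorem zOf_ne_of_segOf_eq_replicate {c : List Bool} {j : ℕ}
    (h : segOf (Δ.segW.eval x.length) c j = List.replicate (Δ.segW.eval x.length) false) (i : Fin (Δ.winCard σ x.length)) :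
    Δ.zOf x c j ≠ ((Δ.winEnum σ x.length i : Δ.window σ x.length) : List Bool) := by
  intro heq
  have h1 := segStr_segOf (Δ := Δ) (x := x) c j
  rw [h, heq] at h1
  have h2 := congrArg List.length h1
  rw [length_segStr_replicate] at h2
  exact Δ.length_winEnum_ne (Δ.two_reach_le_segW x.length) i h2.symm

/-- The code of a round has length `Lc`. [folklore] -/
theorem length_code (r : ℕ) : (Δ.code B σ x G r).length = Δ.codeLen.eval x.length := Δ.length_roundCode x _

/-- **The strings a code names in the window are its probes**: `InS (code r) w ↔ ∃ k < Cs, probe r k = w`. [cite: FennerFortnowKurtzLi2003IC, Lemma 6.17 (p. 33, dom β)] -/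
theorem InS_code_iff (r : ℕ) (i : Fin (Δ.winCard σ x.length)) :
    InS (Δ.segW.eval x.length) (Δ.code B σ x G r) ((Δ.winEnum σ x.length i : Δ.window σ x.length) : List Bool) ↔
      ∃ k < Δ.slots.eval x.length, Δ.probe B σ x G r k = ((Δ.winEnum σ x.length i : Δ.window σ x.length) : List Bool) := by
  unfold InS probe
  constructor
  · rintro ⟨j, hj⟩
    rw [segStr_segOf] at hj
    refine ⟨j, ?_, hj⟩
    by_contra hjl
    refine zOf_ne_of_segOf_eq_replicate (segOf_eq_replicate_of_le ?_) i hj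
    rw [length_code, codeLen_eq]
    exact Nat.mul_le_mul_right _ (not_lt.1 hjl)
  · rintro ⟨k, -, hk⟩
    exact ⟨k, by rw [segStr_segOf]; exact hk⟩

/-- `ValS` of a code at a window string. [folklore] -/
theorem ValS_code_iff (r : ℕ) (i : Fin (Δ.winCard σ x.length)) :
    ValS (Δ.segW.eval x.length) (Δ.code B σ x G r) ((Δ.winEnum σ x.length i : Δ.window σ x.length) : List Bool) ↔
      ∃ k, Δ.probe B σ x G r k = ((Δ.winEnum σ x.length i : Δ.window σ x.length) : List Bool) ∧
        segVal (segOf (Δ.segW.eval x.length) (Δ.code B σ x G r) k) := by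
  unfold ValS probe
  simp only [segStr_segOf]

/-- The history of `r ≤ rounds` complete rounds is the concatenation of their segments. [folklore] -/
theorem histR_eq (r : ℕ) (hr : r ≤ Δ.rounds.eval x.length) :
    Δ.histR B σ x G r = ((List.range (r * Δ.slots.eval x.length)).map fun j =>
      Δ.seg B σ x G (j / Δ.slots.eval x.length) (j % Δ.slots.eval x.length)).flatten := by
  rw [histR, fullHist, codeLen_eq, show r * (Δ.slots.eval x.length * Δ.segW.eval x.length) =
      (r * Δ.slots.eval x.length) * Δ.segW.eval x.length by ring,
    take_flatten_blocks length_of_mem_allSegs, allSegs, ← List.map_take, List.take_range,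
    min_eq_left (Nat.mul_le_mul_right _ hr)]

/-- Indices below `r·Cs` are the pairs `(r', k)` with `r' < r`, `k < Cs`. [folklore] -/
theorem exists_lt_mul_iff {r C : ℕ} (P : ℕ → ℕ → Prop) :
    (∃ j < r * C, P (j / C) (j % C)) ↔ ∃ r' < r, ∃ k < C, P r' k := by
  constructor
  · rintro ⟨j, hj, hP⟩
    have hC : 0 < C := Nat.pos_of_ne_zero fun h => by simp [h] at hj
    refine ⟨j / C, ?_, j % C, Nat.mod_lt _ hC, hP⟩
    rwa [Nat.div_lt_iff_lt_mul hC]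
  · rintro ⟨r', hr', k, hk, hP⟩
    refine ⟨r' * C + k, ?_, ?_⟩
    · calc r' * C + k < r' * C + C := by omega
        _ = (r' + 1) * C := by ring
        _ ≤ r * C := Nat.mul_le_mul_right _ hr'
    · have hC : 0 < C := by omega
      have h1 : (r' * C + k) / C = r' := by
        rw [Nat.add_comm, Nat.add_mul_div_right _ _ hC, Nat.div_eq_of_lt hk, Nat.zero_add]
      have h2 : (r' * C + k) % C = k := by
        rw [Nat.add_comm, Nat.add_mul_mod_self_right, Nat.mod_eq_of_lt hk]
      rwa [h1, h2]

/-- **The knowledge read off the history of `r` rounds**: a window string is known iff some earlier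
round probed it, with `G`'s value. [cite: FennerFortnowKurtzLi2003IC, Fig. 1 (p. 29, "α := α ∪ (G restricted to …)")] -/
theorem knowOf_histR (r : ℕ) (hr : r ≤ Δ.rounds.eval x.length) (i : Fin (Δ.winCard σ x.length)) :
    Δ.knowOf σ x.length (Δ.segW.eval x.length) (Δ.histR B σ x G r) i =
      if ∃ r' < r, ∃ k < Δ.slots.eval x.length, Δ.probe B σ x G r' k = ((Δ.winEnum σ x.length i : Δ.window σ x.length) : List Bool)
      then some (Δ.xG σ x G i) else none := by
  classical
  have hlen : ∀ b ∈ (List.range (r * Δ.slots.eval x.length)).map (fun j =>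
      Δ.seg B σ x G (j / Δ.slots.eval x.length) (j % Δ.slots.eval x.length)), b.length = Δ.segW.eval x.length := by
    intro b hb
    obtain ⟨j, -, rfl⟩ := List.mem_map.1 hb
    exact length_seg _ _
  have hIn : InS (Δ.segW.eval x.length) (Δ.histR B σ x G r) ((Δ.winEnum σ x.length i : Δ.window σ x.length) : List Bool) ↔
      ∃ r' < r, ∃ k < Δ.slots.eval x.length,
        Δ.probe B σ x G r' k = ((Δ.winEnum σ x.length i : Δ.window σ x.length) : List Bool) := by
    rw [histR_eq r hr, InS_flatten_iff hlen (Δ.length_winEnum_ne (Δ.two_reach_le_segW x.length) i),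
      ← exists_lt_mul_iff fun r' k => Δ.probe B σ x G r' k = _]
    constructor
    · rintro ⟨b, hb, hbw⟩
      obtain ⟨j, hj, rfl⟩ := List.mem_map.1 hb
      rw [segStr_seg] at hbw
      exact ⟨j, List.mem_range.1 hj, hbw⟩
    · rintro ⟨j, hj, hP⟩
      exact ⟨_, List.mem_map.2 ⟨j, List.mem_range.2 hj, rfl⟩, by rw [segStr_seg]; exact hP⟩
  have hVal : ValS (Δ.segW.eval x.length) (Δ.histR B σ x G r) ((Δ.winEnum σ x.length i : Δ.window σ x.length) : List Bool) ↔
      (∃ r' < r, ∃ k < Δ.slots.eval x.length,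
        Δ.probe B σ x G r' k = ((Δ.winEnum σ x.length i : Δ.window σ x.length) : List Bool)) ∧ Δ.xG σ x G i = true := by
    rw [histR_eq r hr, ValS_flatten_iff hlen]
    constructor
    · rintro ⟨b, hb, hbw, hv⟩
      obtain ⟨j, hj, rfl⟩ := List.mem_map.1 hb
      rw [segStr_seg] at hbw
      rw [segVal_seg, hbw] at hv
      refine ⟨(exists_lt_mul_iff fun r' k => Δ.probe B σ x G r' k = _).1 ⟨j, List.mem_range.1 hj, hbw⟩, hv⟩
    · rintro ⟨hex, hx⟩
      obtain ⟨j, hj, hP⟩ := (exists_lt_mul_iff fun r' k => Δ.probe B σ x G r' k = _).2 hex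
      refine ⟨_, List.mem_map.2 ⟨j, List.mem_range.2 hj, rfl⟩, by rw [segStr_seg]; exact hP, ?_⟩
      rw [segVal_seg, hP]
      exact hx
  unfold knowOf
  by_cases hex : ∃ r' < r, ∃ k < Δ.slots.eval x.length,
      Δ.probe B σ x G r' k = ((Δ.winEnum σ x.length i : Δ.window σ x.length) : List Bool)
  · rw [if_pos (hIn.2 hex), if_pos hex]
    cases hx : Δ.xG σ x G i
    · rw [if_neg (fun h => by simpa [hx] using (hVal.1 h).2)]
    · rw [if_pos (hVal.2 ⟨hex, hx⟩)]
  · rw [if_neg (fun h => hex (hIn.1 h)), if_neg hex]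

/-- With no good code the round's probes are not window strings. [folklore] -/
theorem probe_ne_of_pick_eq_none {r : ℕ} (h : Δ.pickX B σ x (Δ.knowR B σ x G r) = none) (k : ℕ)
    (i : Fin (Δ.winCard σ x.length)) :
    Δ.probe B σ x G r k ≠ ((Δ.winEnum σ x.length i : Δ.window σ x.length) : List Bool) := by
  unfold probe code
  rw [Δ.roundCode_eq_of_not_exists (Δ.pick_eq_none_iff.1 h)]
  refine zOf_ne_of_segOf_eq_replicate ?_ i
  unfold segOf UnaryOffsets.window
  rw [List.drop_replicate, List.replicate_append_replicate, List.take_replicate]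
  congr 1
  omega

/-- **The knowledge of the Standard Algorithm after `r` rounds**: a window string is known iff
some earlier round probed it. [cite: FennerFortnowKurtzLi2003IC, Fig. 1 and Lemma 6.9 (p. 29)] -/
theorem knowR_eq (r : ℕ) (i : Fin (Δ.winCard σ x.length)) :
    Δ.knowR B σ x G r i =
      if ∃ r' < r, ∃ k < Δ.slots.eval x.length, Δ.probe B σ x G r' k = ((Δ.winEnum σ x.length i : Δ.window σ x.length) : List Bool)
      then some (Δ.xG σ x G i) else none := by
  classical
  induction r generalizing i with
  | zero => simp [knowR, StdAlg.know]
  | succ r ih =>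
    have hsplit : (∃ r' < r + 1, ∃ k < Δ.slots.eval x.length,
        Δ.probe B σ x G r' k = ((Δ.winEnum σ x.length i : Δ.window σ x.length) : List Bool)) ↔
        (∃ r' < r, ∃ k < Δ.slots.eval x.length,
          Δ.probe B σ x G r' k = ((Δ.winEnum σ x.length i : Δ.window σ x.length) : List Bool)) ∨
        ∃ k < Δ.slots.eval x.length, Δ.probe B σ x G r k = ((Δ.winEnum σ x.length i : Δ.window σ x.length) : List Bool) := by
      constructor
      · rintro ⟨r', hr', hk⟩
        rcases Nat.lt_succ_iff_lt_or_eq.1 hr' with h | rfl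
        · exact Or.inl ⟨r', h, hk⟩
        · exact Or.inr hk
      · rintro (⟨r', hr', hk⟩ | hk)
        · exact ⟨r', Nat.lt_succ_of_lt hr', hk⟩
        · exact ⟨r, Nat.lt_succ_self r, hk⟩
    cases hp : Δ.pickX B σ x (Δ.knowR B σ x G r) with
    | none =>
      have hstep : Δ.knowR B σ x G (r + 1) = Δ.knowR B σ x G r := StdAlg.know_succ_of_none hp
      rw [hstep, ih]
      have hno : ¬ ∃ k < Δ.slots.eval x.length,
          Δ.probe B σ x G r k = ((Δ.winEnum σ x.length i : Δ.window σ x.length) : List Bool) :=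
        fun ⟨k, _, hk⟩ => probe_ne_of_pick_eq_none hp k i hk
      by_cases hex : ∃ r' < r, ∃ k < Δ.slots.eval x.length,
          Δ.probe B σ x G r' k = ((Δ.winEnum σ x.length i : Δ.window σ x.length) : List Bool)
      · rw [if_pos hex, if_pos (hsplit.2 (Or.inl hex))]
      · rw [if_neg hex, if_neg (fun h => (hsplit.1 h).elim hex hno)]
    | some β =>
      have hstep : Δ.knowR B σ x G (r + 1) = assign (Δ.xG σ x G) (knownSet β).toList (Δ.knowR B σ x G r) :=
        StdAlg.know_succ_of_some hp
      obtain ⟨c, hc, rfl⟩ := Δ.exists_of_pick_eq_some hp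
      have hcode : Δ.code B σ x G r = c := Δ.roundCode_eq_of_isLeastGood hc
      rw [hstep]
      unfold assign
      have hmem : i ∈ (knownSet (Δ.effCert σ x.length (Δ.segW.eval x.length) (Δ.knowR B σ x G r) c)).toList ↔
          Δ.knowR B σ x G r i = none ∧
            ∃ k < Δ.slots.eval x.length, Δ.probe B σ x G r k = ((Δ.winEnum σ x.length i : Δ.window σ x.length) : List Bool) := by
        rw [Finset.mem_toList, knownSet, Finset.mem_filter, ← InS_code_iff, hcode]
        simp only [Finset.mem_univ, true_and]
        unfold effCert
        split_ifs with h
        · rw [Option.isSome_iff_ne_none, ne_eq, Δ.knowOf_eq_none_iff, not_not]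
          simp [h]
        · simp [h]
      by_cases hm : i ∈ (knownSet (Δ.effCert σ x.length (Δ.segW.eval x.length) (Δ.knowR B σ x G r) c)).toList
      · rw [if_pos hm, if_pos (hsplit.2 (Or.inr (hmem.1 hm).2))]
      · rw [if_neg hm, ih]
        by_cases hex : ∃ r' < r, ∃ k < Δ.slots.eval x.length,
            Δ.probe B σ x G r' k = ((Δ.winEnum σ x.length i : Δ.window σ x.length) : List Bool)
        · rw [if_pos hex, if_pos (hsplit.2 (Or.inl hex))]
        · rw [if_neg hex, if_neg]
          intro h
          rcases hsplit.1 h with h | h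
          · exact hex h
          · refine hm (hmem.2 ⟨?_, h⟩)
            rw [ih, if_neg hex]

/-- **The knowledge read off the history of `r ≤ rounds` rounds is the knowledge of the Standard
Algorithm after `r` rounds.** [cite: FennerFortnowKurtzLi2003IC, Fig. 1 (p. 29)] -/
theorem knowOf_histR_eq_knowR (r : ℕ) (hr : r ≤ Δ.rounds.eval x.length) :
    Δ.knowOf σ x.length (Δ.segW.eval x.length) (Δ.histR B σ x G r) = Δ.knowR B σ x G r :=
  funext fun i => by rw [knowOf_histR r hr i, knowR_eq r i]

end Run

/-! ### The machine's run is the canonical run -/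

section Main

variable {Δ : AWPPDescr} {B : Language Bool} {σ : CohenCondition} {x : List Bool} {G : Language Bool}

/-- The segment at block index `r·Cs + k`. [folklore] -/
theorem getElem_allSegs {r k : ℕ} (hk : k < Δ.slots.eval x.length)
    (hj : r * Δ.slots.eval x.length + k < (Δ.allSegs B σ x G).length) :
    (Δ.allSegs B σ x G)[r * Δ.slots.eval x.length + k] = Δ.seg B σ x G r k := by
  have hC : 0 < Δ.slots.eval x.length := by omega
  have h1 : (r * Δ.slots.eval x.length + k) / Δ.slots.eval x.length = r := by
    rw [Nat.add_comm, Nat.add_mul_div_right _ _ hC, Nat.div_eq_of_lt hk, Nat.zero_add]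
  have h2 : (r * Δ.slots.eval x.length + k) % Δ.slots.eval x.length = k := by
    rw [Nat.add_comm, Nat.add_mul_mod_self_right, Nat.mod_eq_of_lt hk]
  simp only [allSegs, List.getElem_map, List.getElem_range, h1, h2]

/-- Block indices of the run are in range. [folklore] -/
theorem blockIdx_lt {r k : ℕ} (hr : r < Δ.rounds.eval x.length) (hk : k < Δ.slots.eval x.length) :
    r * Δ.slots.eval x.length + k < (Δ.allSegs B σ x G).length := by
  rw [length_allSegs]
  calc r * Δ.slots.eval x.length + k < (r + 1) * Δ.slots.eval x.length := by rw [Nat.succ_mul]; omega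
    _ ≤ Δ.rounds.eval x.length * Δ.slots.eval x.length := Nat.mul_le_mul_right _ hr

/-- Times of the run as block offsets. [folklore] -/
theorem time_eq (r k o : ℕ) :
    r * Δ.codeLen.eval x.length + k * Δ.segW.eval x.length + o = (r * Δ.slots.eval x.length + k) * Δ.segW.eval x.length + o := by
  rw [codeLen_eq]; ring

/-- Reading a bit of the full history. [folklore] -/
theorem getD_fullHist {r k o : ℕ} (hr : r < Δ.rounds.eval x.length) (hk : k < Δ.slots.eval x.length)
    (ho : o < Δ.segW.eval x.length) :
    (Δ.fullHist B σ x G).getD (r * Δ.codeLen.eval x.length + k * Δ.segW.eval x.length + o) false =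
      (Δ.seg B σ x G r k).getD o false := by
  rw [time_eq, fullHist, getD_flatten_blocks length_of_mem_allSegs (blockIdx_lt hr hk) ho, getElem_allSegs hk]

/-- The code bits of a segment are the bits of the round's code. [folklore] -/
theorem getD_seg_of_lt (r k : ℕ) {o : ℕ} (ho : o < Δ.codeW.eval x.length) :
    (Δ.seg B σ x G r k).getD o false = (Δ.code B σ x G r).getD (k * Δ.segW.eval x.length + o) false := by
  have hoW : o < Δ.segW.eval x.length := by rw [segW_eq]; omega
  rw [seg, List.getD_eq_getElem?_getD, List.getElem?_append_left (by
      rw [List.length_take, segOf, UnaryOffsets.length_window, segW_eq]; omega),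
    List.getElem?_take, if_pos ho, ← List.getD_eq_getElem?_getD]
  exact UnaryOffsets.getD_window _ _ _ hoW

/-- The last bit of a segment is `G`'s answer. [folklore] -/
theorem getD_seg_codeW (r k : ℕ) :
    (Δ.seg B σ x G r k).getD (Δ.codeW.eval x.length) false = G.boolIndicator (Δ.probe B σ x G r k) := by
  have hl : ((segOf (Δ.segW.eval x.length) (Δ.code B σ x G r) k).take (Δ.codeW.eval x.length)).length = Δ.codeW.eval x.length := by
    rw [List.length_take, segOf, UnaryOffsets.length_window, segW_eq]; omega
  rw [seg, List.getD_eq_getElem?_getD, List.getElem?_append_right (le_of_eq hl), hl, Nat.sub_self]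
  rfl

/-- The code part received in the current segment, read back off the history. [folklore] -/
theorem drop_take_fullHist {r k : ℕ} (hr : r < Δ.rounds.eval x.length) (hk : k < Δ.slots.eval x.length) :
    ((Δ.fullHist B σ x G).take (r * Δ.codeLen.eval x.length + k * Δ.segW.eval x.length + Δ.codeW.eval x.length)).drop
        (r * Δ.codeLen.eval x.length + k * Δ.segW.eval x.length) =
      (segOf (Δ.segW.eval x.length) (Δ.code B σ x G r) k).take (Δ.codeW.eval x.length) := by
  rw [List.drop_take, Nat.add_sub_cancel_left, show r * Δ.codeLen.eval x.length + k * Δ.segW.eval x.length =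
      (r * Δ.slots.eval x.length + k) * Δ.segW.eval x.length by rw [codeLen_eq]; ring, fullHist,
    take_drop_flatten_blocks length_of_mem_allSegs (blockIdx_lt hr hk) (by rw [segW_eq]; omega), getElem_allSegs hk, seg,
    List.take_append_of_le_length (by rw [List.length_take, segOf, UnaryOffsets.length_window, segW_eq]; omega),
    List.take_take, min_self]

/-- `boolIndicator` through a membership equivalence. [folklore] -/
theorem boolIndicator_eq_of_iff {L : Language Bool} {s : List Bool} {b : Bool} (h : s ∈ L ↔ b = true) :
    L.boolIndicator s = b := by
  cases b
  · exact (Set.notMem_iff_boolIndicator _ _).1 fun hs => Bool.false_ne_true (h.1 hs)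
  · exact (Set.mem_iff_boolIndicator _ _).1 (h.2 rfl)

/-- **The machine's answer bits are the canonical history**, as long as `B` answers the Karp
images of the questions `⟨x, h⟩ ∈ K` correctly: induction on the time `t = r·Lc + k·W + o` — a
code bit is the bit `k·W + o` of the round's code (the `PSPACE` side recomputes the knowledge
`ρ_r` from the completed rounds, `knowOf_histR_eq_knowR`, and spells its least good code,
`mem_KLang_iff_kbit`), a probe is answered by `G` on the string spelled by the segment's code bits
(`drop_take_fullHist`). [cite: FennerFortnowKurtzLi2003IC, Lemma 6.16 (p. 33) and Fig. 1 (p. 29)] -/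
theorem adBits_eq_take (hwf : Δ.WellFormed) (hcat : Δ.Categorical B σ) {f : List Bool → List Bool}
    (hf : ∀ u : List Bool, u ∈ Δ.KLang B σ ↔ f u ∈ B) :
    ∀ t, t ≤ Δ.rounds.eval x.length * Δ.codeLen.eval x.length →
      AdQuery.adBits (Δ.qryFn f) (oracleJoin B G) x t = (Δ.fullHist B σ x G).take t
  | 0, _ => by simp
  | t + 1, ht => by
    have ht' : t < Δ.rounds.eval x.length * Δ.codeLen.eval x.length := ht
    have htlt : t < Δ.rounds.eval x.length * Δ.codeLen.eval x.length := ht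
    have ih := adBits_eq_take hwf hcat hf t ht'.le
    rw [AdQuery.adBits_succ, ih]
    have hlen : ((Δ.fullHist B σ x G).take t).length = t := by
      rw [List.length_take, length_fullHist, min_eq_left ht'.le]
    have htake : (Δ.fullHist B σ x G).take (t + 1) = (Δ.fullHist B σ x G).take t ++ [(Δ.fullHist B σ x G).getD t false] := by
      have htl : t < (Δ.fullHist B σ x G).length := by rw [length_fullHist]; exact ht'
      rw [← List.take_append_getElem htl, List.getD_eq_getElem?_getD, List.getElem?_eq_getElem htl]
      rfl
    rw [htake]
    congr 1
    rw [List.singleton_inj]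
    rw [codeLen_eq, ← Nat.mul_assoc] at ht'
    have hTpos : 0 < Δ.codeW.eval x.length := by rw [Δ.codeW_eval]; omega
    obtain ⟨r, k, o, hr, hk, ho, hteq, hdiv, hmod, hdd, hdm⟩ := exists_time_decomp
      (show t < Δ.rounds.eval x.length * (Δ.slots.eval x.length * Δ.segW.eval x.length) by rwa [Nat.mul_assoc] at ht')
    rw [← codeLen_eq] at hteq
    by_cases hoT : o = Δ.codeW.eval x.length
    · -- a probe is due: `G` answers on the string spelled by the code bits
      subst hoT
      rw [Δ.qryFn_of_pend f (by rw [hlen, hmod]), hlen, hdiv,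
        show (r * Δ.slots.eval x.length + k) * Δ.segW.eval x.length = r * Δ.codeLen.eval x.length + k * Δ.segW.eval x.length by
          rw [codeLen_eq]; ring]
      conv_lhs => rw [hteq]
      rw [drop_take_fullHist hr hk, hteq, getD_fullHist hr hk ho, getD_seg_codeW]
      refine boolIndicator_eq_of_iff ?_
      rw [true_cons_mem_oracleJoin]
      exact Set.mem_iff_boolIndicator _ _
    · -- a code bit: `B` answers the Karp image of `⟨x, h⟩ ∈ K`
      have hoT' : o < Δ.codeW.eval x.length := by rw [segW_eq] at ho; omega
      rw [Δ.qryFn_of_not_pend f (by rw [hlen, hmod]; exact hoT)]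
      refine boolIndicator_eq_of_iff ?_
      rw [false_cons_mem_oracleJoin, ← hf, Δ.mem_KLang_iff_kbit hwf hcat]
      unfold kbit
      rw [if_neg (show ((Δ.fullHist B σ x G).take t).length ≠ Δ.histLen.eval x.length by
        rw [hlen, Δ.histLen_eval]; exact ne_of_lt htlt)]
      unfold prefKnow bitIdx
      rw [hlen, hdd, hdm, hmod, List.take_take, min_eq_left (by rw [hteq]; omega), ← histR, knowOf_histR_eq_knowR r hr.le,
        ← code, hteq, getD_fullHist hr hk ho, getD_seg_of_lt r k hoT']

/-- **The machine decides the description**: for `Δ` well formed and categorical over `σ`, `G`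
extending `σ`, and `B` answering the Karp images of `K` correctly, the machine accepts `x` iff
`x ∈ L(Δ^{B ⊕ G})`. The last answer is the verdict `f(fill(ρ_R))` of the Standard Algorithm after
`R = 4·reachPoly² ≥ bs(f)` rounds (`StdAlg.decide_eq` with `pickSpec`), i.e. `f(x_G)`, i.e.
membership (`mem_lang_iff_winFn`). [cite: FennerFortnowKurtzLi2003IC, Lemma 6.9 (p. 29), Lemma 6.16 and Lemma 6.17 (p. 33)] -/
theorem mem_machineLang_iff (hwf : Δ.WellFormed) (hcat : Δ.Categorical B σ) (hG : σ.ExtendedBy G)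
    {f : List Bool → List Bool} (hf : ∀ u : List Bool, u ∈ Δ.KLang B σ ↔ f u ∈ B) (x : List Bool) :
    x ∈ Δ.machineLang B f G ↔ x ∈ Δ.lang B G := by
  have hfull : AdQuery.adBits (Δ.qryFn f) (oracleJoin B G) x (Δ.rounds.eval x.length * Δ.codeLen.eval x.length) =
      Δ.fullHist B σ x G := by
    rw [adBits_eq_take hwf hcat hf _ le_rfl, ← length_fullHist, List.take_length]
  rw [machineLang, AdQuery.mem_adLang_iff, budget, eval_add, eval_one, Δ.histLen_eval, AdQuery.adBits_succ, hfull]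
  show sndP (boolPair x (Δ.fullHist B σ x G ++ _)) ∈ BrainProtocol.LastTrue ↔ _
  rw [sndP_boolPair, BrainProtocol.append_singleton_mem_LastTrue]
  -- the last query is the verdict query, answered by `K`
  have hlen : (Δ.fullHist B σ x G).length % Δ.segW.eval x.length ≠ Δ.codeW.eval x.length := by
    rw [length_fullHist, codeLen_eq, ← Nat.mul_assoc, Nat.mul_mod_left, Δ.codeW_eval]
    omega
  rw [Δ.qryFn_of_not_pend f hlen]
  have hK : (false :: f (boolPair x (Δ.fullHist B σ x G)) ∈ oracleJoin B G) ↔ Δ.kbit B σ x (Δ.fullHist B σ x G) = true := by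
    rw [false_cons_mem_oracleJoin, ← hf, Δ.mem_KLang_iff_kbit hwf hcat]
  rw [boolIndicator_eq_of_iff hK]
  unfold kbit
  rw [if_pos (by rw [length_fullHist, Δ.histLen_eval])]
  -- the verdict is `StdAlg.decide`, which is `f(x_G)`
  have hhist : Δ.fullHist B σ x G = Δ.histR B σ x G (Δ.rounds.eval x.length) := by
    rw [histR, ← length_fullHist, List.take_length]
  rw [hhist, knowOf_histR_eq_knowR _ le_rfl]
  have hdec : Δ.winFn B σ x (fill (Δ.knowR B σ x G (Δ.rounds.eval x.length))) =
      StdAlg.decide (Δ.winFn B σ x) (Δ.pickX B σ x) (Δ.xG σ x G) (Δ.rounds.eval x.length) := rfl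
  have hspec : StdAlg.PickSpec (Δ.winFn B σ x) (Δ.pickX B σ x) := by
    unfold pickX
    rw [codeLen_eq]
    exact Δ.pickSpec hcat x (Δ.two_reach_le_segW x.length) (Δ.certBound_le_slots x.length)
  rw [hdec, StdAlg.decide_eq hspec (Δ.xG σ x G) ((Δ.blockSensitivity_winFn_le hcat x).trans ?_), xG,
    ← Δ.mem_lang_iff_winFn hwf hG x]
  rw [Δ.rounds_eval]
  exact Nat.mul_le_mul_left _ (Nat.pow_le_pow_left (Δ.reach_le_reachPoly x.length) 2)

end Main

end AWPPDescr

/-! ### Assembly: the Standard Algorithm statement and the named fact -/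

/-- **The Standard Algorithm statement** (the hypothesis `hstd` of
`fennerFortnowKurtzLi2003_thm618_awpp_of_stdAlg`): for every Karp-`PSPACE`-complete `B`, every
well-formed description `Δ` categorical over a finite condition `σ`, and every `G` extending `σ`,
`L(Δ^{B ⊕ G}) ∈ P^{B ⊕ G}` — the machine above, with `K ∈ PSPACE` Karp-reduced to `B`
(Lemma 6.16 with `F_j ∈ FPSPACE`, Lemma 6.17, and `P^B = PSPACE`, Thm. 6.18 (2), pp. 33–34).
[cite: FennerFortnowKurtzLi2003IC, Lemma 6.16, Lemma 6.17 and Thm. 6.18 (2) (p. 33), pp. 33–34] -/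
theorem stdAlg_collapse (B : Language Bool) (hB : IsComplete PSPACE B) (Δ : AWPPDescr) (hwf : Δ.WellFormed)
    (σ : CohenCondition) (hcat : Δ.Categorical B σ) (G : Language Bool) (hG : σ.ExtendedBy G) :
    Δ.lang B G ∈ PRel (Oracle.ofLanguage (oracleJoin B G)) := by
  obtain ⟨f, hf, hr⟩ := karpReducible_of_isComplete hB (Δ.KLang_mem_PSPACE hB hwf σ)
  have heq : Δ.lang B G = Δ.machineLang B f G :=
    Set.ext fun x => (Δ.mem_machineLang_iff hwf hcat hG hr x).symm
  rw [heq]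
  exact Δ.machineLang_mem_PRel B hf G

/-- **Fenner–Fortnow–Kurtz–Li Thm. 6.18 (2), rerelativized (= Fortnow–Rogers Thm. 3.6 joined with a
`PSPACE`-complete set): the named fact `fennerFortnowKurtzLi2003_thm618_awpp` holds** — for every
Karp-`PSPACE`-complete `B` there is a countable family `𝒮` of sets of Cohen conditions such that
`P^{B ⊕ G} = AWPP^{B ⊕ G}` for every `𝒮`-generic `G`. Proof: `FFKLGenericCollapse.lean`
(requirements, density, genericity: `fennerFortnowKurtzLi2003_thm618_awpp_of_stdAlg`) with the
Standard Algorithm for categorical descriptions (`stdAlg_collapse`: Thm. 6.13 certificates,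
Lemma 6.17 supplier in `PSPACE`, Lemma 6.9/6.16 machine).
[cite: FennerFortnowKurtzLi2003IC, Thm. 6.18 (2) (p. 33), Lemma 6.8, Lemma 6.9, Thm. 6.13, Lemma 6.16, Lemma 6.17, pp. 33–34] [cite: FortnowRogers1999JCSS, Thm. 3.6 (arXiv numbering)] -/
theorem fennerFortnowKurtzLi2003_thm618_awpp_holds : fennerFortnowKurtzLi2003_thm618_awpp :=
  fennerFortnowKurtzLi2003_thm618_awpp_of_stdAlg stdAlg_collapse



end Literature.Barriers.QuantumAdvantage

end
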